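import Literature.NumberTheory.Automorphic.DerivWeightSlice
import Literature.NumberTheory.Automorphic.AutomorphicRepsGLCuspidalKFiniteGarding
import HarnessLib

/-!
# Linearity of the archimedean derivative on test functions of `GL_n(𝔸_K)`; scalar multiples

Topic `NumberTheory/Automorphic`; namespace `Literature.NumberTheory.Automorphic`. Small shared
helpers (theorems only) for the Kirillov `L²`-bound files of the `n ≤ 2` case of the named fact
`JacquetShalika1981_partialPairL_pole_of_eq_conj` (archimedean word expansion and finite-place shell
smoothing alike): for test functions `θ` (`IsTestFunctionGL`) the orbit `t ↦ θ((exp tX, 1)⁻¹ h)` is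
differentiable, so `derivWeight` is additive over finite sums of test functions and commutes with real
scalars; real scalar multiples of test functions are test functions (`IsTestFunctionGL.const_smul`),
and so are all archimedean word derivatives (`isTestFunctionGL_wordDerivWeight'`). Standard calculus
(Bump (1997), §2.2, (2.28)–(2.29)). No definitions, no named facts.

## References

* D. Bump, *Automorphic Forms and Representations*, CUP (1997), §2.2 [Bump1997].
-/

noncomputable section

open scoped MatrixGroups Classical ContDiff
open NumberField NumberField.mixedEmbedding IsDedekindDomain MeasureTheory

namespace Literature.NumberTheory.Automorphic

variable {n : ℕ} {K : Type} [Field K] [NumberField K]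
  (hcpt : isCompact_glFiniteIntegralLevel n K)

set_option backward.isDefEq.respectTransparency false
set_option synthInstance.maxHeartbeats 400000

attribute [local instance 100] LieRing.ofAssociativeRing

open scoped Matrix.Norms.Operator

/-- The orbit `t ↦ θ((exp tX, 1)⁻¹ h)` of a test function is differentiable at `0`. [folklore] -/
theorem differentiableAt_weight_expMem {θ : GL (Fin n) (AdeleRing (𝓞 K) K) → ℝ} (hθ : IsTestFunctionGL n K θ)
    (X : (AutomorphyDatum.gl n K hcpt).arch.lie) (h : (AdelicGroupData.gl n K).Adelic) :
    DifferentiableAt ℝ (fun t : ℝ => θ (((AutomorphyDatum.gl n K hcpt).ofArch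
      ((AutomorphyDatum.gl n K hcpt).arch.expMem (t • X)))⁻¹ * h)) 0 := by
  have hd := hasDerivAt_comp_exp_neg_smul (hθ.contDiff_leftArchSlice h) (X : Matrix (Fin n) (Fin n) (mixedSpace K)) 1
  have heq : (fun t : ℝ => θ (((AutomorphyDatum.gl n K hcpt).ofArch
      ((AutomorphyDatum.gl n K hcpt).arch.expMem (t • X)))⁻¹ * h)) =
      fun t : ℝ => leftArchSlice θ h (NormedSpace.exp (-(t • (X : Matrix (Fin n) (Fin n) (mixedSpace K)))) * 1) := by
    funext t
    exact weight_ofArch_expMem_inv_mul hcpt θ X t h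
  rw [heq]
  exact hd.differentiableAt

/-- **The derivative of a finite sum of test functions** is the sum of the derivatives. [cite: Bump1997, (2.29)] -/
theorem derivWeight_sum_testFunction {ι' : Type*} (s : Finset ι') {θ : ι' → GL (Fin n) (AdeleRing (𝓞 K) K) → ℝ}
    (hθ : ∀ i ∈ s, IsTestFunctionGL n K (θ i)) (X : (AutomorphyDatum.gl n K hcpt).arch.lie) :
    derivWeight (AutomorphyDatum.gl n K hcpt).ofArch X (∑ i ∈ s, θ i) =
      ∑ i ∈ s, derivWeight (AutomorphyDatum.gl n K hcpt).ofArch X (θ i) :=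
  derivWeight_finset_sum _ s θ X fun i hi g => differentiableAt_weight_expMem hcpt (hθ i hi) X g

/-- The derivative of two test functions' sum. [folklore] -/
theorem derivWeight_add_testFunction {θ θ' : GL (Fin n) (AdeleRing (𝓞 K) K) → ℝ} (hθ : IsTestFunctionGL n K θ)
    (hθ' : IsTestFunctionGL n K θ') (X : (AutomorphyDatum.gl n K hcpt).arch.lie) :
    derivWeight (AutomorphyDatum.gl n K hcpt).ofArch X (θ + θ') =
      derivWeight (AutomorphyDatum.gl n K hcpt).ofArch X θ + derivWeight (AutomorphyDatum.gl n K hcpt).ofArch X θ' := by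
  funext g
  simp only [derivWeight, Pi.add_apply]
  exact deriv_fun_add (differentiableAt_weight_expMem hcpt hθ X g) (differentiableAt_weight_expMem hcpt hθ' X g)

/-- **The derivative of a real scalar multiple of a weight.** [folklore] -/
theorem derivWeight_smul_weight (a : ℝ) (θ : GL (Fin n) (AdeleRing (𝓞 K) K) → ℝ) (X : (AutomorphyDatum.gl n K hcpt).arch.lie) :
    derivWeight (AutomorphyDatum.gl n K hcpt).ofArch X (a • θ) = a • derivWeight (AutomorphyDatum.gl n K hcpt).ofArch X θ := by
  funext g
  simp only [derivWeight, Pi.smul_apply, smul_eq_mul]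
  exact deriv_const_mul_field a

/-- **Real scalar multiples of test functions are test functions.** [folklore] -/
theorem IsTestFunctionGL.const_smul {θ : GL (Fin n) (AdeleRing (𝓞 K) K) → ℝ} (hθ : IsTestFunctionGL n K θ) (a : ℝ) :
    IsTestFunctionGL n K (a • θ) := by
  refine ⟨hθ.continuous.const_smul a, hθ.hasCompactSupport.mono (Function.support_const_smul_subset a θ), ?_, ?_⟩
  · have h : IsArchSmooth (AutomorphyDatum.gl n K (isCompact_glFiniteIntegralLevel_holds n K)).ofArch ((a : ℂ) • fun g => ((θ g : ℝ) : ℂ)) :=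
      (archSmooth (AutomorphyDatum.gl n K (isCompact_glFiniteIntegralLevel_holds n K)).ofArch).smul_mem (a : ℂ) (show _ ∈ _ from hθ.isArchSmooth)
    have e : (fun g : (AdelicGroupData.gl n K).Adelic => (((a • θ) g : ℝ) : ℂ)) = (a : ℂ) • fun g => ((θ g : ℝ) : ℂ) := by
      funext g
      simp only [Pi.smul_apply, smul_eq_mul, Complex.ofReal_mul]
    rw [e]
    exact h
  · obtain ⟨U, hU, hUθ⟩ := hθ.2.2.2
    exact ⟨U, hU, fun u hu g => by simp only [Pi.smul_apply, hUθ u hu g]⟩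

/-- Word derivatives of scalar multiples. [folklore] -/
theorem wordDerivWeight_smul_weight (a : ℝ) (θ : GL (Fin n) (AdeleRing (𝓞 K) K) → ℝ) :
    ∀ w : List (AutomorphyDatum.gl n K hcpt).arch.lie,
      wordDerivWeight (AutomorphyDatum.gl n K hcpt).ofArch w (a • θ) = a • wordDerivWeight (AutomorphyDatum.gl n K hcpt).ofArch w θ
  | [] => rfl
  | X :: w => by rw [wordDerivWeight_cons, wordDerivWeight_cons, wordDerivWeight_smul_weight a θ w, derivWeight_smul_weight]

/-- **Archimedean word derivatives of a test function are test functions.** [folklore] -/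
theorem isTestFunctionGL_wordDerivWeight' {θ : GL (Fin n) (AdeleRing (𝓞 K) K) → ℝ} (hθ : IsTestFunctionGL n K θ) :
    ∀ w : List (AutomorphyDatum.gl n K hcpt).arch.lie,
      IsTestFunctionGL n K (wordDerivWeight (AutomorphyDatum.gl n K hcpt).ofArch w θ)
  | [] => hθ
  | X :: w => by
    rw [wordDerivWeight_cons]
    exact isTestFunctionGL_derivWeight hcpt (isTestFunctionGL_wordDerivWeight' hθ w) X

/-- Word derivatives of finite sums of test functions. [folklore] -/
theorem wordDerivWeight_sum_testFunction {ι' : Type*} (s : Finset ι') {θ : ι' → GL (Fin n) (AdeleRing (𝓞 K) K) → ℝ}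
    (hθ : ∀ i ∈ s, IsTestFunctionGL n K (θ i)) :
    ∀ w : List (AutomorphyDatum.gl n K hcpt).arch.lie,
      wordDerivWeight (AutomorphyDatum.gl n K hcpt).ofArch w (∑ i ∈ s, θ i) =
        ∑ i ∈ s, wordDerivWeight (AutomorphyDatum.gl n K hcpt).ofArch w (θ i)
  | [] => rfl
  | X :: w => by
    rw [wordDerivWeight_cons, wordDerivWeight_sum_testFunction s hθ w,
      derivWeight_sum_testFunction hcpt s (fun i hi => isTestFunctionGL_wordDerivWeight' hcpt (hθ i hi) w) X]
    simp only [wordDerivWeight_cons]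

/-- **Word derivatives of left translates by elements with trivial archimedean component**:
`(L_g θ)_w = L_g (θ_w)` when `g_∞ = 1`. [cite: Bump1997, (2.29)] -/
theorem wordDerivWeight_leftTranslateWeight_of_toMixed_eq_one {θ : GL (Fin n) (AdeleRing (𝓞 K) K) → ℝ} (hθ : IsTestFunctionGL n K θ)
    {g : (AdelicGroupData.gl n K).Adelic} (hg : GLn.toMixed n K g = 1) :
    ∀ w : List (AutomorphyDatum.gl n K hcpt).arch.lie,
      wordDerivWeight (AutomorphyDatum.gl n K hcpt).ofArch w (leftTranslateWeight (n := n) g θ) =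
        leftTranslateWeight (n := n) g (wordDerivWeight (AutomorphyDatum.gl n K hcpt).ofArch w θ)
  | [] => rfl
  | X :: w => by
    rw [wordDerivWeight_cons, wordDerivWeight_cons, wordDerivWeight_leftTranslateWeight_of_toMixed_eq_one hθ hg w,
      derivWeight_leftTranslateWeight hcpt (isTestFunctionGL_wordDerivWeight' hcpt hθ w) X g, hg]
    congr 1
    have h1 : adInvLie hcpt (1 : GL (Fin n) (mixedSpace K)) X = X := by
      apply Subtype.ext
      rw [coe_adInvLie]
      simp
    rw [h1]

end Literature.NumberTheory.Automorphic
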